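import Summits.FinalStateConjecture.FinalStateConjecture.Theorems.EIHFluxBalanceInertialRecessionFibred
import Summits.FinalStateConjecture.FinalStateConjecture.Theorems.EIHFluxBalanceInertialRecessionClampField

/-!
# Route EIHFluxBalance — `InertialRecession`: the Fermi-type re-charting map of a moving hole

Helper file for the crux `stmt-FinalStateConjecture-10166`
(`Summit.FinalStateConjecture.FinalStateConjecture.Theses.EIHFluxBalance.InertialRecession`).

For a hole with painted centre `ξ(t)`, painted lab velocity `v(t)` and final velocity `V`
(`Λ∞ = boost V`), the hole chart of the re-charting is `Φ ∘ A` with the **Fermi-type map**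
`A = F₄ ∘ F₃ ∘ F₂ ∘ F₁ : E4 → E4`,
* `F₁ x' = (x'⁰, (Λ∞⁻¹ x')~)` — lab time and rest offset of the straight model point;
* `F₂ (w, y̲) = (θ(w), y̲)`, `θ(w) = T + 1 + σ(w − T − 1)` — the strict time clamp onto `(T, ∞)`;
* `F₃ (t, y̲) = (t, g(t, y̲))` — the coordinate clamp field into the cube of side `2ρ(t)`;
* `F₄ (t, z) = (t, ξ(t) + L_{v(t)} z)` — the rest placement.
This file assembles the properties of `A` from the sibling files `…Fibred`, `…ClampField`,
`…BoostAlgebra`: `A` is smooth and an open embedding of `E4` (`contDiff_fermiMap`,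
`isOpenEmbedding_fermiMap'`, registered form unprimed); its lab time is `θ(x'⁰) > T`, equal to `x'⁰` from `T + 1` on, and its
lab offset from the painted centre is `L_{v(θ)}` of the clamped rest offset, of norm `< 2ρ(θ)`
(`fermiMap_apply`, `fermiMap_apply_zero`, `norm_spatial_fermiMap_sub_lt`); on the honest zone
`{x'⁰ ≥ T + 1, ‖y̲‖ ≤ ρ(x'⁰)/2}` it is the honest placement `(x'⁰, ξ(x'⁰) + L_{v(x'⁰)} y̲)`
(`fermiMap_eq_of_honest`); and the painted spin-`0` Kerr–Schild radius of `A x'` relative to ANY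
frame with lab velocity `v(θ)` centred at `(θ, ξ(θ))` is the norm of the clamped offset, which
lies in `[min(‖y̲‖, ρ/2), ‖y̲‖]` (`spatialNorm_symm_fermiMap_sub'`, registered form unprimed) — exact horizon normalisation.
-/

noncomputable section

open scoped Topology ContDiff InnerProductSpace
open Filter Set Metric Function TopologicalSpace Literature.Geometry.Lorentzian

namespace Summit.FinalStateConjecture.FinalStateConjecture.Theorems

/-! ### Smoothness of the building blocks -/

/-- `y ↦ (θ(y⁰), y̲)` is smooth for smooth `θ`. [folklore] -/
theorem contDiff_timeReparam {θ : ℝ → ℝ} (hθ : ContDiff ℝ ∞ θ) :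
    ContDiff ℝ ∞ fun y : E4 ↦ E4.ofTimeSpace (θ (y 0)) (E4.spatial y) := by
  have h0 : ContDiff ℝ ∞ fun y : E4 ↦ y 0 := (EuclideanSpace.proj (0 : Fin 4) : E4 →L[ℝ] ℝ).contDiff
  have hfun : (fun y : E4 ↦ E4.ofTimeSpace (θ (y 0)) (E4.spatial y)) =
      fun y ↦ (θ (y 0)) • E4.basisVector 0 + E4.spaceEmbed (E4.spatial y) :=
    funext fun y ↦ E4.ofTimeSpace_eq_smul_add' _ _
  rw [hfun]
  exact ((hθ.comp h0).smul contDiff_const).add (E4.spaceEmbed.contDiff.comp E4.spatial.contDiff)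

/-- `y ↦ (y⁰, g(y⁰, y̲))` is smooth for jointly smooth `g`. [folklore] -/
theorem contDiff_fibredMap {g : ℝ → E3 → E3} (hg : ContDiff ℝ ∞ fun p : ℝ × E3 ↦ g p.1 p.2) :
    ContDiff ℝ ∞ fun y : E4 ↦ E4.ofTimeSpace (y 0) (g (y 0) (E4.spatial y)) := by
  have h0 : ContDiff ℝ ∞ fun y : E4 ↦ y 0 := (EuclideanSpace.proj (0 : Fin 4) : E4 →L[ℝ] ℝ).contDiff
  have hfun : (fun y : E4 ↦ E4.ofTimeSpace (y 0) (g (y 0) (E4.spatial y))) =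
      fun y ↦ (y 0) • E4.basisVector 0 + E4.spaceEmbed (g (y 0) (E4.spatial y)) :=
    funext fun y ↦ E4.ofTimeSpace_eq_smul_add' _ _
  rw [hfun]
  exact (h0.smul contDiff_const).add
    (E4.spaceEmbed.contDiff.comp (hg.comp (h0.prodMk E4.spatial.contDiff)))

/-- The rest placement `(t, z) ↦ ξ(t) + L_{v(t)} z` is jointly smooth. [folklore] -/
theorem contDiff_restPlacement_uncurry {ξ v : ℝ → E3} (hξ : ContDiff ℝ ∞ ξ) (hv : ContDiff ℝ ∞ v)
    (hv1 : ∀ t, ‖v t‖ < 1) :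
    ContDiff ℝ ∞ fun p : ℝ × E3 ↦ ξ p.1 +
      (p.2 - (Lorentz.gamma (v p.1) / (Lorentz.gamma (v p.1) + 1) * inner ℝ (v p.1) p.2) • v p.1) := by
  set Lf : E3 → E3 →L[ℝ] E3 := fun u ↦ ContinuousLinearMap.id ℝ E3 -
    (Lorentz.gamma u / (Lorentz.gamma u + 1)) • (innerSL ℝ u).smulRight u with hLf
  have hLa : ∀ u z, Lf u z = z - (Lorentz.gamma u / (Lorentz.gamma u + 1) * inner ℝ u z) • u :=
    fun u z ↦ restOffsetCLM_apply u z
  have hLv : ContDiff ℝ ∞ fun t ↦ Lf (v t) := by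
    have hmaps : ∀ t, v t ∈ ball (0 : E3) 1 := fun t ↦ by simpa using hv1 t
    refine contDiff_iff_contDiffAt.mpr fun t ↦ ?_
    exact ((contDiffOn_restOffsetCLM (v t) (hmaps t)).contDiffAt
      (isOpen_ball.mem_nhds (hmaps t))).comp t hv.contDiffAt
  have h : ContDiff ℝ ∞ fun p : ℝ × E3 ↦ ξ p.1 + Lf (v p.1) p.2 :=
    (hξ.comp contDiff_fst).add ((hLv.comp contDiff_fst).clm_apply contDiff_snd)
  simpa only [hLa] using h

/-- `x' ↦ (x'⁰, (Λ⁻¹ x')~)` is smooth. [folklore] -/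
theorem contDiff_labRest (Λ : E4 ≃L[ℝ] E4) :
    ContDiff ℝ ∞ fun x : E4 ↦ E4.ofTimeSpace (x 0) (E4.spatial (Λ.symm x)) := by
  have h0 : ContDiff ℝ ∞ fun y : E4 ↦ y 0 := (EuclideanSpace.proj (0 : Fin 4) : E4 →L[ℝ] ℝ).contDiff
  have hfun : (fun x : E4 ↦ E4.ofTimeSpace (x 0) (E4.spatial (Λ.symm x))) =
      fun x ↦ (x 0) • E4.basisVector 0 + E4.spaceEmbed (E4.spatial (Λ.symm x)) :=
    funext fun x ↦ E4.ofTimeSpace_eq_smul_add' _ _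
  rw [hfun]
  exact (h0.smul contDiff_const).add
    (E4.spaceEmbed.contDiff.comp (E4.spatial.contDiff.comp (Λ.symm : E4 →L[ℝ] E4).contDiff))

/-! ### The Fermi-type map -/

section FermiMap

variable {V : E3} (hV : ‖V‖ < 1) {σ Gt ρ : ℝ → ℝ} {ξ v : ℝ → E3} {T : ℝ} {A : E4 → E4}
  (hA : ∀ x : E4, A x =
    E4.ofTimeSpace (T + 1 + σ (x 0 - T - 1))
      (ξ (T + 1 + σ (x 0 - T - 1)) +
        ((ρ (T + 1 + σ (x 0 - T - 1)) • (WithLp.toLp 2 fun k ↦ Gt ((ρ (T + 1 + σ (x 0 - T - 1)))⁻¹ *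
            E4.spatial ((Lorentz.boost V hV : E4 ≃L[ℝ] E4).symm x) k) : E3)) -
          (Lorentz.gamma (v (T + 1 + σ (x 0 - T - 1))) /
              (Lorentz.gamma (v (T + 1 + σ (x 0 - T - 1))) + 1) *
            inner ℝ (v (T + 1 + σ (x 0 - T - 1)))
              (ρ (T + 1 + σ (x 0 - T - 1)) • (WithLp.toLp 2 fun k ↦
                Gt ((ρ (T + 1 + σ (x 0 - T - 1)))⁻¹ *
                  E4.spatial ((Lorentz.boost V hV : E4 ≃L[ℝ] E4).symm x) k) : E3))) •
            v (T + 1 + σ (x 0 - T - 1)))))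

include hA in
/-- **The Fermi-type map is a composite** `A = F₄ ∘ F₃ ∘ F₂ ∘ F₁` of the lab/rest splitting, the
time clamp, the clamp field and the rest placement. [folklore] -/
theorem fermiMap_eq_comp :
    A = (fun y : E4 ↦ E4.ofTimeSpace (y 0) (ξ (y 0) + (E4.spatial y -
          (Lorentz.gamma (v (y 0)) / (Lorentz.gamma (v (y 0)) + 1) * inner ℝ (v (y 0)) (E4.spatial y)) •
            v (y 0)))) ∘
      (fun y : E4 ↦ E4.ofTimeSpace (y 0)
        (ρ (y 0) • (WithLp.toLp 2 fun k ↦ Gt ((ρ (y 0))⁻¹ * E4.spatial y k) : E3))) ∘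
      (fun y : E4 ↦ E4.ofTimeSpace (T + 1 + σ (y 0 - T - 1)) (E4.spatial y)) ∘
      (fun x : E4 ↦ E4.ofTimeSpace (x 0) (E4.spatial ((Lorentz.boost V hV : E4 ≃L[ℝ] E4).symm x))) := by
  funext x
  rw [hA x]
  simp only [comp_apply, E4.spatial_ofTimeSpace, E4.ofTimeSpace_apply_zero]

include hA in
/-- **The Fermi-type map is smooth.** [folklore] -/
theorem contDiff_fermiMap (hσ : ContDiff ℝ ∞ σ) (hGt : ContDiff ℝ ∞ Gt) (hρ : ContDiff ℝ ∞ ρ)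
    (hρ0 : ∀ t, 0 < ρ t) (hξ : ContDiff ℝ ∞ ξ) (hv : ContDiff ℝ ∞ v) (hv1 : ∀ t, ‖v t‖ < 1) :
    ContDiff ℝ ∞ A := by
  rw [fermiMap_eq_comp hV hA]
  have hθ : ContDiff ℝ ∞ fun w ↦ T + 1 + σ (w - T - 1) :=
    contDiff_const.add (hσ.comp ((contDiff_id.sub contDiff_const).sub contDiff_const))
  refine (contDiff_fibredMap (g := fun t z ↦ ξ t + (z -
    (Lorentz.gamma (v t) / (Lorentz.gamma (v t) + 1) * inner ℝ (v t) z) • v t))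
    (contDiff_restPlacement_uncurry hξ hv hv1)).comp ?_
  refine (contDiff_fibredMap (g := fun t z ↦ ρ t • (WithLp.toLp 2 fun k ↦ Gt ((ρ t)⁻¹ * z k) : E3))
    (contDiff_clampField hGt hρ hρ0)).comp ?_
  exact (contDiff_timeReparam hθ).comp (contDiff_labRest _)

include hA in
/-- **The Fermi-type map is an open embedding of `E4`.** [folklore] -/
theorem isOpenEmbedding_fermiMap' (hσ : ContDiff ℝ ∞ σ) (hσ' : ∀ s, 0 < deriv σ s)
    (hGt : ContDiff ℝ ∞ Gt) (hGm : StrictMono Gt) (hGd : ∀ u, 0 < deriv Gt u) (hρ : ContDiff ℝ ∞ ρ)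
    (hρ0 : ∀ t, 0 < ρ t) (hξ : ContDiff ℝ ∞ ξ) (hv : ContDiff ℝ ∞ v) (hv1 : ∀ t, ‖v t‖ < 1) :
    Topology.IsOpenEmbedding A := by
  rw [fermiMap_eq_comp hV hA]
  have hθ : ContDiff ℝ ∞ fun w ↦ T + 1 + σ (w - T - 1) :=
    contDiff_const.add (hσ.comp ((contDiff_id.sub contDiff_const).sub contDiff_const))
  have hθ' : ∀ w, 0 < deriv (fun w ↦ T + 1 + σ (w - T - 1)) w := by
    intro w
    have hσd : Differentiable ℝ σ := hσ.differentiable (by simp)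
    have h1 : HasDerivAt (fun w ↦ w - T - 1) (1 : ℝ) w := by
      simpa using ((hasDerivAt_id w).sub_const T).sub_const 1
    have h2 : HasDerivAt (fun w ↦ T + 1 + σ (w - T - 1)) (deriv σ (w - T - 1) * 1) w :=
      ((hσd _).hasDerivAt.comp w h1).const_add _
    rw [h2.deriv, mul_one]
    exact hσ' _
  refine (isOpenEmbedding_restPlacement' hξ hv hv1).comp ?_
  refine (isOpenEmbedding_fibred' (g := fun t z ↦ ρ t • (WithLp.toLp 2 fun k ↦ Gt ((ρ t)⁻¹ * z k) : E3))
    (contDiff_clampField hGt hρ hρ0)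
    (injective_clampField hGm hρ0) (injective_fderiv_clampField' hGt hGd hρ hρ0)).comp ?_
  exact (isOpenEmbedding_timeReparam hθ hθ').comp (isOpenEmbedding_labRest hV)

include hA in
/-- The lab time of `A x'` is the clamped time `θ(x'⁰) = T + 1 + σ(x'⁰ − T − 1)`. [folklore] -/
theorem fermiMap_apply_zero (x : E4) : A x 0 = T + 1 + σ (x 0 - T - 1) := by
  rw [hA x, E4.ofTimeSpace_apply_zero]

include hA in
/-- The lab time of `A x'` exceeds `T` (for the strict time clamp `σ > −1`). [folklore] -/
theorem lt_fermiMap_apply_zero (hσ1 : ∀ s, -1 < σ s) (x : E4) : T < A x 0 := by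
  rw [fermiMap_apply_zero hV hA]
  linarith [hσ1 (x 0 - T - 1)]

include hA in
/-- From lab time `T + 1` on, the lab time of `A x'` is `x'⁰` (`σ = id` on `[0, ∞)`). [folklore] -/
theorem fermiMap_apply_zero_of_le (hσid : ∀ s, 0 ≤ s → σ s = s) {x : E4} (hx : T + 1 ≤ x 0) :
    A x 0 = x 0 := by
  rw [fermiMap_apply_zero hV hA, hσid _ (by linarith)]
  ring

include hA in
/-- The lab offset of `A x'` from the painted centre is `L_{v(θ)}` of the clamped rest offset,
hence of norm `< 2ρ(θ)`. [folklore] -/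
theorem norm_spatial_fermiMap_sub_lt (hGlt : ∀ u, |Gt u| < 1) (hρ0 : ∀ t, 0 < ρ t)
    (hv1 : ∀ t, ‖v t‖ < 1) (x : E4) :
    ‖E4.spatial (A x) - ξ (A x 0)‖ < 2 * ρ (A x 0) := by
  rw [fermiMap_apply_zero hV hA, hA x, E4.spatial_ofTimeSpace, add_sub_cancel_left]
  exact (norm_restOffset_le (hv1 _) _).trans_lt (norm_clampField_lt hGlt hρ0 _ _)

include hA in
/-- **Honest zone.** For `x'⁰ ≥ T + 1` and `‖(Λ∞⁻¹x')~‖ ≤ ρ(x'⁰)/2` the Fermi-type map is the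
honest placement `A x' = (x'⁰, ξ(x'⁰) + L_{v(x'⁰)} (Λ∞⁻¹x')~)`. [folklore] -/
theorem fermiMap_eq_of_honest (hσid : ∀ s, 0 ≤ s → σ s = s) (hGid : ∀ u, |u| ≤ 1 / 2 → Gt u = u)
    (hρ0 : ∀ t, 0 < ρ t) {x : E4} (hx : T + 1 ≤ x 0)
    (hy : ‖E4.spatial ((Lorentz.boost V hV : E4 ≃L[ℝ] E4).symm x)‖ ≤ ρ (x 0) / 2) :
    A x = E4.ofTimeSpace (x 0) (ξ (x 0) +
      (E4.spatial ((Lorentz.boost V hV : E4 ≃L[ℝ] E4).symm x) -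
        (Lorentz.gamma (v (x 0)) / (Lorentz.gamma (v (x 0)) + 1) *
          inner ℝ (v (x 0)) (E4.spatial ((Lorentz.boost V hV : E4 ≃L[ℝ] E4).symm x))) • v (x 0))) := by
  have hθ : T + 1 + σ (x 0 - T - 1) = x 0 := by rw [hσid _ (by linarith)]; ring
  rw [hA x, hθ, clampField_eq_self hGid hρ0 (x 0) hy]

include hA in
/-- **Exact horizon normalisation of the Fermi-type map.** Relative to ANY Lorentz frame `Λ'`
whose time leg is future pointing with lab velocity `v(θ)`, `θ` the lab time of `A x'`, centred at
`(θ, ξ(θ))`, the painted spin-`0` Kerr–Schild radius `‖(Λ'⁻¹(A x' − (θ, ξ(θ))))~‖` is the norm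
of the clamped rest offset; in particular it lies in `[min(‖y̲‖, ρ(θ)/2), ‖y̲‖]`,
`y̲ = (Λ∞⁻¹x')~`. [folklore] -/
theorem spatialNorm_symm_fermiMap_sub' (hGid : ∀ u, |u| ≤ 1 / 2 → Gt u = u)
    (hGgt : ∀ u, 1 / 2 < |u| → 1 / 2 < |Gt u|) (hGle : ∀ u, |Gt u| ≤ |u|) (hρ0 : ∀ t, 0 < ρ t)
    (x : E4) (Λ' : lorentzGroup) (h0 : 0 < ((Λ' : E4 ≃L[ℝ] E4) (E4.basisVector 0)) 0)
    (hvΛ : E4.spatial ((Λ' : E4 ≃L[ℝ] E4) (E4.basisVector 0)) =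
      (((Λ' : E4 ≃L[ℝ] E4) (E4.basisVector 0)) 0) • v (A x 0)) :
    min ‖E4.spatial ((Lorentz.boost V hV : E4 ≃L[ℝ] E4).symm x)‖ (ρ (A x 0) / 2) ≤
        E4.spatialNorm ((Λ' : E4 ≃L[ℝ] E4).symm (A x - E4.ofTimeSpace (A x 0) (ξ (A x 0)))) ∧
      E4.spatialNorm ((Λ' : E4 ≃L[ℝ] E4).symm (A x - E4.ofTimeSpace (A x 0) (ξ (A x 0)))) ≤
        ‖E4.spatial ((Lorentz.boost V hV : E4 ≃L[ℝ] E4).symm x)‖ := by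
  set θ := T + 1 + σ (x 0 - T - 1) with hθ
  have hA0 : A x 0 = θ := fermiMap_apply_zero hV hA x
  set z : E3 := ρ θ • (WithLp.toLp 2 fun k ↦ Gt ((ρ θ)⁻¹ *
    E4.spatial ((Lorentz.boost V hV : E4 ≃L[ℝ] E4).symm x) k) : E3) with hz
  have hdiff : A x - E4.ofTimeSpace (A x 0) (ξ (A x 0)) =
      E4.ofTimeSpace 0 (z - (Lorentz.gamma (v θ) / (Lorentz.gamma (v θ) + 1) * inner ℝ (v θ) z) •
        v θ) := by
    rw [hA0, hA x, ← hθ, ← hz, ← sub_eq_zero, ← E4.ofTimeSpace_time_spatial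
      (E4.ofTimeSpace θ _ - E4.ofTimeSpace θ (ξ θ) - E4.ofTimeSpace 0 _), E4.time_apply]
    simp only [PiLp.sub_apply, E4.ofTimeSpace_apply_zero, map_sub, E4.spatial_ofTimeSpace]
    rw [show θ - θ - 0 = (0 : ℝ) by ring, show ξ θ + (z - _ • v θ) - ξ θ - (z - _ • v θ) = (0 : E3)
      by abel]
    rw [E4.ofTimeSpace_eq_smul_add', zero_smul, zero_add, map_zero]
  rw [hA0] at hvΛ
  rw [hdiff, spatialNorm_symm_ofTimeSpace_restOffset' Λ' h0 hvΛ z, hA0]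
  exact ⟨min_le_norm_clampField' hGid hGgt hρ0 θ _, norm_clampField_le hGle hρ0 θ _⟩

end FermiMap

/-! ### Registered forms -/

/-- Registered sub-goal form (stub `isOpenEmbedding_fermiMap` of the crux item) of
`isOpenEmbedding_fermiMap'`. [folklore] -/
theorem isOpenEmbedding_fermiMap : open Literature.Geometry.Lorentzian in ∀ {V : E3} (hV : ‖V‖ < 1) {σ Gt ρ : ℝ → ℝ} {ξ v : ℝ → E3} {T : ℝ} {A : E4 → E4}, (∀ x : E4, A x = E4.ofTimeSpace (T + 1 + σ (x 0 - T - 1)) (ξ (T + 1 + σ (x 0 - T - 1)) + ((ρ (T + 1 + σ (x 0 - T - 1)) • (WithLp.toLp 2 fun k ↦ Gt ((ρ (T + 1 + σ (x 0 - T - 1)))⁻¹ * E4.spatial ((Lorentz.boost V hV : E4 ≃L[ℝ] E4).symm x) k) : E3)) - (Lorentz.gamma (v (T + 1 + σ (x 0 - T - 1))) / (Lorentz.gamma (v (T + 1 + σ (x 0 - T - 1))) + 1) * inner ℝ (v (T + 1 + σ (x 0 - T - 1))) (ρ (T + 1 + σ (x 0 - T - 1)) • (WithLp.toLp 2 fun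 k ↦ Gt ((ρ (T + 1 + σ (x 0 - T - 1)))⁻¹ * E4.spatial ((Lorentz.boost V hV : E4 ≃L[ℝ] E4).symm x) k) : E3))) • v (T + 1 + σ (x 0 - T - 1))))) → ContDiff ℝ ((⊤ : ℕ∞) : WithTop ℕ∞) σ → (∀ s, 0 < deriv σ s) → ContDiff ℝ ((⊤ : ℕ∞) : WithTop ℕ∞) Gt → StrictMono Gt → (∀ u, 0 < deriv Gt u) → ContDiff ℝ ((⊤ : ℕ∞) : WithTop ℕ∞) ρ → (∀ t, 0 < ρ t) → ContDiff ℝ ((⊤ : ℕ∞) : WithTop ℕ∞) ξ → ContDiff ℝ ((⊤ : ℕ∞) : WithTop ℕ∞) v → (∀ t, ‖v t‖ < 1) → Topology.IsOpenEmbedding A :=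
  fun hV _ _ _ _ _ _ _ hA hσ hσ' hGt hGm hGd hρ hρ0 hξ hv hv1 ↦
    isOpenEmbedding_fermiMap' hV hA hσ hσ' hGt hGm hGd hρ hρ0 hξ hv hv1

/-- Registered sub-goal form (stub `spatialNorm_symm_fermiMap_sub` of the crux item) of
`spatialNorm_symm_fermiMap_sub'`. [folklore] -/
theorem spatialNorm_symm_fermiMap_sub : open Literature.Geometry.Lorentzian in ∀ {V : E3} (hV : ‖V‖ < 1) {σ Gt ρ : ℝ → ℝ} {ξ v : ℝ → E3} {T : ℝ} {A : E4 → E4}, (∀ x : E4, A x = E4.ofTimeSpace (T + 1 + σ (x 0 - T - 1)) (ξ (T + 1 + σ (x 0 - T - 1)) + ((ρ (T + 1 + σ (x 0 - T - 1)) • (WithLp.toLp 2 fun k ↦ Gt ((ρ (T + 1 + σ (x 0 - T - 1)))⁻¹ * E4.spatial ((Lorentz.boost V hV : E4 ≃L[ℝ] E4).symm x) k) : E3)) - (Lorentz.gamma (v (T + 1 + σ (x 0 - T - 1))) / (Lorentz.gamma (v (T + 1 + σ (x 0 - T - 1))) + 1) * inner ℝ (v (T + 1 + σ (x 0 - T -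 1))) (ρ (T + 1 + σ (x 0 - T - 1)) • (WithLp.toLp 2 fun k ↦ Gt ((ρ (T + 1 + σ (x 0 - T - 1)))⁻¹ * E4.spatial ((Lorentz.boost V hV : E4 ≃L[ℝ] E4).symm x) k) : E3))) • v (T + 1 + σ (x 0 - T - 1))))) → (∀ u, |u| ≤ 1 / 2 → Gt u = u) → (∀ u, 1 / 2 < |u| → 1 / 2 < |Gt u|) → (∀ u, |Gt u| ≤ |u|) → (∀ t, 0 < ρ t) → ∀ (x : E4) (Λ' : lorentzGroup), 0 < ((Λ' : E4 ≃L[ℝ] E4) (E4.basisVector 0)) 0 → E4.spatial ((Λ' : E4 ≃L[ℝ] E4) (E4.basisVector 0)) = (((Λ' : E4 ≃L[ℝ] E4) (E4.basisVector 0)) 0) • v (A x 0) → min ‖E4.spatial ((Lorentz.boost V hV : E4 ≃L[ℝ] E4).symm x)‖ (ρ (A x 0) / 2) ≤ E4.spatialNorm ((Λ' : E4 ≃L[ℝ] E4).symm (A x - E4.ofTimeSpace (A x 0) (ξ (A x 0)))) ∧ E4.spatialNorm ((Λ' : E4 ≃L[ℝ] E4).symm (A x - E4.ofTimeSpace (A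 x 0) (ξ (A x 0)))) ≤ ‖E4.spatial ((Lorentz.boost V hV : E4 ≃L[ℝ] E4).symm x)‖ :=
  fun hV _ _ _ _ _ _ _ hA hGid hGgt hGle hρ0 x Λ' h0 hvΛ ↦
    spatialNorm_symm_fermiMap_sub' hV hA hGid hGgt hGle hρ0 x Λ' h0 hvΛ

end Summit.FinalStateConjecture.FinalStateConjecture.Theorems

end
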